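import Mathlib.Tactic.NormNum
import Mathlib.Tactic.IntervalCases
import Literature.IUT.HodgeTheaters.InitialThetaData
import Summits.ABC.IUTFork.Cor312Provenance
import HarnessLib

/-!
# [IUTchIV] Thm. 1.10's "`l ≠ 5`" from [IUTchI] Def. 3.1 (c): the input `l ≥ 7` of `numbersOf` DISCHARGED (c312 crew, wave 2, W2-F companion)

Record-only companion (seat abc-iut-c312-8; board row W2-F) of `Cor312Provenance.lean`; TAKES NO SIDE on Cor. 3.12.
[IUTchIV] Theorem 1.10 (kurims p. 22, last lines of the hypotheses): "Moreover, we assume that the `(3·5)`-torsion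
points of `E_F` are defined over `F` … [Thus, it follows from Proposition 1.8, (iv), that `E_F ≅ E_{F_tpd} ×_{F_tpd} F`
over `F`, and from [IUTchI], Definition 3.1, (c), that `l ≠ 5`.]" — whence `l ≥ 7` for the prime `l ≥ 5`, which is
what the skeleton's `Thm110Data.seven_le_l` (`ForkThm110.lean`) and the input `Cor312Prov.Thm110Inputs.seven_le_l`
ask for. This file PROVES that bracketed inference from abc-iut-L5-t2's typing of Def. 3.1 (c)
(`InitialThetaData.imageContainsSL2`: "the image of `G_F → GL₂(𝔽_l)` … contains `SL₂(𝔽_l)`", via an `𝔽_l`-basis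
`(P, Q)` of `E_F[l](F̄)` on which every determinant-one matrix is a Galois element): if every `l`-torsion point were
fixed by `G_F`, the element realising `(1 1; 0 1)` would give `P + Q = Q`, i.e. `P = 0`, contradicting the
independence of the basis (`torsion_not_all_fixed`); so rational `15`-torsion forces `l ≠ 5` (`l_ne_five_of_torsion15_fixed`)
and, `l` being a prime `≥ 5`, `l ≥ 7` (`seven_le_l_of_torsion15_fixed`). "Defined over `F`" is read as "fixed by every
`σ ∈ G_F = Gal(F̄/F)`" (the Galois-fixed form of rationality; L5-t2's `torsion_six_rational` uses the base-change-range
form for the `2·3`-torsion of Def. 3.1 (b) — the two agree for `F̄/F` Galois, not re-proved here).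
[claim: Mochizuki2012, status: disputed] for the quotations; the theorems are elementary and PROVED.
-/

namespace Summit.ABC.IUTFork.Cor312Prov

open Literature.IUT.HodgeTheaters
open scoped Classical

universe u v w

variable {F : Type u} {K : Type v} {Fbar : Type w} [Field F] [NumberField F] [Field K] [NumberField K]
  [Algebra F K] [Field Fbar] [Algebra F Fbar] [Algebra K Fbar] {E : WeierstrassCurve F} [E.IsElliptic]
  {l : ℕ} {Pb : BadPlacePredicates K}

/-- "The `n`-torsion points of `E_F` are defined over `F`" ([IUTchIV] Thm. 1.10, p. 22: "`(3·5)`-torsion"), in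
Galois-fixed form: every `F̄`-point killed by `n` is fixed by every `σ ∈ G_F` (L5-t2's `galoisAct`).
[claim: Mochizuki2012, status: disputed] -/
@[claim "Mochizuki2012" "disputed"]
def TorsionFixed (E : WeierstrassCurve F) (Fbar : Type w) [Field Fbar] [Algebra F Fbar] (n : ℕ) : Prop :=
  ∀ (σ : Fbar ≃ₐ[F] Fbar) (T : GeomPoints Fbar E), (n : ℤ) • T = 0 → galoisAct E σ T = T

omit [NumberField F] [E.IsElliptic] in
/-- If `m ∣ n`, rational `n`-torsion gives rational `m`-torsion. PROVED. [folklore] -/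
theorem TorsionFixed.of_dvd {m n : ℕ} (h : TorsionFixed E Fbar n) (hmn : m ∣ n) : TorsionFixed E Fbar m := by
  intro σ T hT
  obtain ⟨k, rfl⟩ := hmn
  refine h σ T ?_
  rw [Nat.cast_mul, mul_comm, mul_smul, hT, smul_zero]

omit [NumberField F] [E.IsElliptic] in
/-- The heart of "[IUTchI], Definition 3.1, (c) ⟹ `l ≠ 5`" ([IUTchIV] p. 22): if the image of `G_F → GL₂(𝔽_l)` contains
`SL₂(𝔽_l)` (L5-t2's `ImageContainsSL2`, Def. 3.1 (c)) and `l > 1`, then NOT every `l`-torsion point is Galois-fixed —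
the Galois element realising the determinant-one matrix `(1 1; 0 1)` moves `Q` to `P + Q ≠ Q`. PROVED.
[claim: Mochizuki2012, status: disputed] -/
theorem torsion_not_all_fixed (h : ImageContainsSL2 Fbar E l) (hl : 1 < l) : ¬ TorsionFixed E Fbar l := by
  intro hfix
  obtain ⟨P, Q, _, hQ, hind, -, hreal⟩ := h.exists_basis
  obtain ⟨σ, -, hσQ⟩ := hreal 1 1 0 1 (by norm_num)
  have hQfix : galoisAct E σ Q = Q := hfix σ Q hQ
  have hPQ : P + Q = Q := by simpa using hσQ.symm.trans hQfix
  have hP0 : P = 0 := by simpa using congrArg (fun x => x - Q) hPQ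
  have hdvd : (l : ℤ) ∣ 1 := (hind 1 0 (by simp [hP0])).1
  have hl1 : l = 1 := Nat.dvd_one.mp (by exact_mod_cast hdvd)
  omega

/-- [IUTchIV] Thm. 1.10, p. 22: "we assume that the `(3·5)`-torsion points of `E_F` are defined over `F` … it follows …
from [IUTchI], Definition 3.1, (c), that `l ≠ 5`" — PROVED for any initial Θ-datum `D` (L5-t2's `InitialThetaData`:
`l` prime `≥ 5` with `ImageContainsSL2`) under the rational-`15`-torsion hypothesis (Galois-fixed form).
[claim: Mochizuki2012, status: disputed] -/
theorem l_ne_five_of_torsion15_fixed (D : InitialThetaData F K Fbar E l Pb) (h15 : TorsionFixed E Fbar 15) :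
    l ≠ 5 := by
  intro h5
  subst h5
  exact torsion_not_all_fixed D.imageContainsSL2 (by norm_num) (h15.of_dvd (by norm_num))

/-- Hence `l ≥ 7` (`l` prime, `l ≥ 5`, `l ≠ 5`): the input `Thm110Inputs.seven_le_l` / skel `Thm110Data.seven_le_l`
DISCHARGED from the datum and [IUTchIV] Thm. 1.10's printed torsion hypothesis. PROVED.
[claim: Mochizuki2012, status: disputed] -/
theorem seven_le_l_of_torsion15_fixed (D : InitialThetaData F K Fbar E l Pb) (h15 : TorsionFixed E Fbar 15) :
    7 ≤ l := by
  have hne := l_ne_five_of_torsion15_fixed D h15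
  have hp := D.l_prime
  have h5 := D.five_le_l
  by_contra hlt
  push Not at hlt
  interval_cases l
  · exact hne rfl
  · exact absurd hp (by decide)

/-- The `Thm110Inputs` of `Cor312Provenance.lean` with its first field supplied by the theorem above: only
`log(q) > 0` (cf. `Cor312ProvenanceDH.logq_pos_of`) and the three [IUTchIV]-only numbers remain inputs.
[claim: Mochizuki2012, status: disputed] -/
noncomputable def Thm110Inputs.ofTorsion15 (D : InitialThetaData F K Fbar E l Pb) (h15 : TorsionFixed E Fbar 15)
    (logq_pos : 0 < logq D) (estar eta logdf : ℝ) (hestar : 0 ≤ estar) (heta : 0 ≤ eta) (hlogdf : 0 ≤ logdf) :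
    Thm110Inputs D where
  seven_le_l := seven_le_l_of_torsion15_fixed D h15
  logq_pos := logq_pos
  estar := estar
  estar_nonneg := hestar
  eta := eta
  eta_nonneg := heta
  logdf := logdf
  logdf_nonneg := hlogdf

/-! ## Appendix (append-only): the printed phrasing "defined over `F`" -/

omit [NumberField F] [E.IsElliptic] in
/-- "The `n`-torsion points of `E_F` are defined over `F`" in the RANGE-OF-BASE-CHANGE form that abc-iut-L5-t2 uses for
the `2·3`-torsion of [IUTchI] Def. 3.1 (b) (`InitialThetaData.torsion_six_rational`) implies the Galois-fixed form
`TorsionFixed`: a base-changed point is fixed by every `F`-algebra automorphism of `F̄` (Mathlib's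
`WeierstrassCurve.Affine.Point.map_baseChange`). PROVED. [folklore] -/
theorem torsionFixed_of_rational {n : ℕ}
    (h : ∀ T : GeomPoints Fbar E, (n : ℤ) • T = 0 →
      T ∈ Set.range (WeierstrassCurve.Affine.Point.baseChange (W' := E.toAffine) F Fbar)) :
    TorsionFixed E Fbar n := by
  intro σ T hT
  obtain ⟨P, rfl⟩ := h T hT
  exact WeierstrassCurve.Affine.Point.map_baseChange (σ : Fbar →ₐ[F] Fbar) P

/-- [IUTchIV] Thm. 1.10, p. 22, IN THE PRINTED PHRASING: "we assume that the `(3·5)`-torsion points of `E_F` are defined over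
`F` … it follows … from [IUTchI], Definition 3.1, (c), that `l ≠ 5`" — hence `l ≥ 7` — with "defined over `F`" = "in the
range of base change from `E_F(F)`" (L5-t2's convention). PROVED (`torsionFixed_of_rational` + `seven_le_l_of_torsion15_fixed`).
[claim: Mochizuki2012, status: disputed] -/
theorem seven_le_l_of_torsion15_rational (D : InitialThetaData F K Fbar E l Pb)
    (h15 : ∀ T : GeomPoints Fbar E, (15 : ℤ) • T = 0 →
      T ∈ Set.range (WeierstrassCurve.Affine.Point.baseChange (W' := E.toAffine) F Fbar)) :
    7 ≤ l :=
  seven_le_l_of_torsion15_fixed D (torsionFixed_of_rational h15)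

end Summit.ABC.IUTFork.Cor312Prov
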